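import Summits.QuantumFields.YangMills.Theorems.BalabanUVNodesN14DecoupledDressing

/-!
# BalabanUVNodes ∕ node N14 = NE1′ — the scale-decoupled dressed tower, part 2: THE RUN's TOTAL DRESSED ACTION, its (2.18)-type
# REPRESENTATION `Z_K(t) = Z_K(0)·e^{𝒟_K(t)}` (`Znorm`), the K-UNIFORM first-order bound, holomorphy in the source, the TWO-RUN RESIDUAL
# (summable ⇒ the `K → ∞` limit of the centred dressed action EXISTS on the K-free window), and the model's twin of the residual
# `DressedMGFForm.TiltedMeanMatching` — a MODEL RUNG, count-neutral

Cell `pub-ymgap`, HUMAN RULING D-0062 (Track A at full width), seat `pub-ymgap-dag-n14-c` (R134 ACCELERATION, strategy s1), generation 2; route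
`Summits/QuantumFields/YangMills/Theses/BalabanUVNodes.lean` (cluster K3, item `SpineGivenEndpointR11`, `--supports`); venue ruling R424
(`YangMills/Theorems`, namespace `YMDAG.N14.Decoupled`).  ADDITIVE — imports this seat's part 1 `Thm/BalabanUVNodesN14DecoupledDressing` (p459546;
`DecoupledRun`, `birthSize`, `amp`, `birthSize_le`, the tower and `dressedStabilityStrict_tower`; through it `B16DressedActionTerm` p453150 and
`B16Ineq175Tilted` p409237) ONLY; THEOREMS + six bookkeeping `def`s (the run's totals, the limit, the majorant); modifies nothing; every cited lemma is used BY NAME.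

WHY.  Part 1 booked the born dressed terms of the SCALE-DECOUPLED run one by one and proved the decl of record `DressedStabilityStrict` on that
tower.  The director's row also names the RESIDUAL `DressedMGFForm.TiltedMeanMatching` (:253): the two-run first-moment statement the MGF road
into `HybridNE7` leaves.  In the decoupled model the run's dressed normalisation with cutoff `K` is the PRODUCT over depths `n ≤ K` of the tilted
normalisations `𝐓′ₜ1 = tiltNorm μ_n ρ₀,ₙ σ_n W_n t`, so everything the consumer rows read of NE1′ is a finite sum over depths of part 1's born
terms — and the row's second half becomes a theorem of the model too, in [Balaban1989LargeFieldII]'s complex currency: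
* §1 TOTALS [model bookkeeping]: `Znorm R K t = ∏_{n ≤ K} 𝐓′ₜ⁽ⁿ⁾1` (the dressed normalisation), `dressedAction R K t = Σ_{n ≤ K} D⁽ⁿ⁾_t` (the total born
  dressed action), `centred R K t = Σ_{n ≤ K} (D⁽ⁿ⁾_t − t·c_n)` (past the field-independent linear part), `tiltedMeanSum R K t = Σ_{n ≤ K} E⁽ⁿ⁾_t W_n`
  (the run's source-tilted mean of the observable = its logarithmic derivative, §3).
* §2 THE (2.18)-TYPE REPRESENTATION WITH THE OBSERVABLE ATTACHED, K-UNIFORM: `Znorm_eq_mul_exp` — on the window `Znorm R K t = Znorm R K 0 · e^{dressedAction R K t}`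
  (`B16DressedActionTerm.exp_dressLog_mul` per depth); `norm_centred_le` — `‖centred R K t‖ ≤ amp·(1 − θ)⁻¹` for EVERY cutoff and every source in
  the window (part 1's `birthSize_le` summed against the geometric series): the dressed action stays in ONE K-free disc — row NE1′'s «constants
  UNIFORM in the cutoff K and in the source μ on a window» for the exponential's observable-attached term, in the model.
* §3 HOLOMORPHY: `hasDerivAt_dressedAction` — on the closed window `d∕dt dressedAction R K t = tiltedMeanSum R K t` (`hasDerivAt_dressLog` per depth);
  `differentiableOn_dressedAction` ∕ `analyticOnNhd_dressedAction` on the open window.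
* §4 TWO RUNS — THE RESIDUAL IN THE MODEL: `centred_succ` — the runs with cutoffs `K + 1` and `K` differ by the DEEPEST born term,
  `norm_centred_succ_sub_le : ‖centred R (K+1) t − centred R K t‖ ≤ amp·θ^{K+1}` — SUMMABLE, hence `cauchySeq_centred` and
  **`tendsto_centred : ∃ D, Tendsto (centred R · t) atTop (𝓝 D)`**: the `K → ∞` (ε → 0) LIMIT OF THE CENTRED DRESSED ACTION EXISTS at every
  source of the K-free window — the T⁴ programme's apex sentence for the dressed free energy, in the decoupled caricature; the tail
  `norm_centred_sub_le` (all cutoffs `K ≤ K'`), the limit `centredLim R t` with the SOURCE-FREE rate `norm_centredLim_sub_le`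
  (`amp·θ^{K+1}·(1−θ)⁻¹`), `tendstoUniformlyOn_centred` on the closed window, and **`differentiableOn_centredLim`**: the continuum dressed action is
  HOLOMORPHIC IN THE SOURCE on the open window (locally uniform limit of holomorphic functions, Mathlib
  `TendstoLocallyUniformlyOn.differentiableOn`) — «analyticity in μ of the continuum limit», the apex's Cauchy∕moment road input, in the model.
* §5 THE MODEL's TWIN OF `TiltedMeanMatching` :253 (complex currency): `tiltedMeanSum_succ` and
  **`norm_tiltedMeanSum_succ_sub_le : ‖(tiltedMeanSum R (K+1) t − Σ_{n≤K+1} c_n) − (tiltedMeanSum R K t − Σ_{n≤K} c_n)‖ ≤ eta R K`**,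
  `eta R K = e^{3(s+l₀B)}·C·θ^{K+1}`, `summable_eta` — the two runs' source-tilted first moments of the observable, centred, agree within a
  SUMMABLE `η`: exactly the pair (`hη`, `hηs`) `DressedMGFForm.hybridNE7_of_mgfForm` consumes, here for the decoupled runs (`K`, `K+1`) sharing
  their top `K + 1` depths; `norm_tiltedMeanSum_sub_le_sum` (all cutoffs), `tendsto_tiltedMeanSum_centred` (the centred tilted means converge as
  `K → ∞`), and `tendsto_tiltedMeanSum_deriv_centredLim`: on the open window that limit IS `deriv (centredLim R) t` — the continuum tilted mean is
  the source-derivative of the continuum dressed action (Mathlib `TendstoLocallyUniformlyOn.deriv`).  (At real `σ`, real `t` the complex tilted mean of a fibre piece IS `DressedMGFForm.tiltedMean` of the piece under the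
  positive law `ρ₀e^{σ}dμ`; that identification, and the product law realising `F_K = Σ_n W_n`, are NOT formalised here — the twin is stated in
  [B16]'s complex currency, where it is a theorem.)

WHAT DECOUPLING DISCHARGES VACUOUSLY — SAID (referee A5): the same as part 1 — the inter-scale transport ∕ regeneration of born terms and the
two-run YOUNG rate: here the two runs share their top depths IDENTICALLY (the young discrepancy of rows NE5∕NE9 is zero by construction), so the
residual is the deepest born term alone.  What is GENUINE: every total is a finite sum of complex-weight integrals under the printed provisos
(1.73)–(1.75); the K-uniformity and the existence of the limit come from the first-order birth bound and the geometric depth decay, nothing else.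

HONEST FRAMING.  A MODEL RUNG over hypothesis SHAPES, NOT a discharge claim: nothing of Bałaban's densities is asserted or instantiated; NE1′ ∕ NE7
NOT PRINTED with observables ([Balaban1989LargeFieldII] p. 356 ll. 1–6) and NOT PROVED; `TiltedMeanMatching` is NOT thereby instantiated on the runs
of record; N14 NOT discharged; count-neutral (typed 28∕28; discharged count unmoved).  One finite four-torus programme at fixed ε; NOT infinite
volume, NOT OS on ℝ⁴, NOT a mass gap, NOT Clay.  [folklore] kernel mathematics over the cited modules; 0 sorry; standard axioms.
-/

noncomputable section

namespace YMDAG.N14.Decoupled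

open MeasureTheory Finset Filter Topology
open scoped BigOperators
open Literature.MathematicalPhysics.QuantumFieldTheory.Balaban1983to89
open Literature.MathematicalPhysics.QuantumFieldTheory.Balaban1983to89.B16Ineq175Tilted (tiltedMean norm_tiltedMean_le)
open Literature.MathematicalPhysics.QuantumFieldTheory.Balaban1983to89.B16DressedActionTerm

variable {Z : Type} [MeasurableSpace Z]

/-! ## §1 The run's totals over depths -/

/-- **THE DRESSED NORMALISATION OF THE DECOUPLED RUN** with cutoff `K` at source `t` [model bookkeeping]: the product over depths `n ≤ K` of the
tilted normalisations `𝐓′ₜ⁽ⁿ⁾1 = ∫ρ₀,ₙe^{σ_n + tW_n}dμ_n` (the steps share no variables). -/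
def Znorm (R : DecoupledRun Z) (K : ℕ) (t : ℂ) : ℂ :=
  ∏ n ∈ range (K + 1), tiltNorm (R.μ n) (R.ρ₀ n) (R.σ n) (R.W n) t

/-- **THE TOTAL BORN DRESSED ACTION** `𝒟_K(t) = Σ_{n ≤ K} D⁽ⁿ⁾_t` [model bookkeeping]. -/
def dressedAction (R : DecoupledRun Z) (K : ℕ) (t : ℂ) : ℂ :=
  ∑ n ∈ range (K + 1), dressLog (R.μ n) (R.ρ₀ n) (R.σ n) (R.W n) t

/-- **THE CENTRED DRESSED ACTION** `Σ_{n ≤ K} (D⁽ⁿ⁾_t − t·c_n)` [model bookkeeping]: past the field-independent linear part `t·Σc_n` (the part no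
normalised step sees). -/
def centred (R : DecoupledRun Z) (K : ℕ) (t : ℂ) : ℂ :=
  ∑ n ∈ range (K + 1), (dressLog (R.μ n) (R.ρ₀ n) (R.σ n) (R.W n) t - t * R.c n)

/-- **THE RUN's SOURCE-TILTED MEAN OF THE OBSERVABLE** `E_K(t) = Σ_{n ≤ K} E⁽ⁿ⁾_t W_n` [model bookkeeping]: the sum over depths of the tilted
normalised expectations of the fibre pieces (`B16Ineq175Tilted.tiltedMean`, scalar instance) — the logarithmic derivative of `Znorm R K` (§3). -/
def tiltedMeanSum (R : DecoupledRun Z) (K : ℕ) (t : ℂ) : ℂ :=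
  ∑ n ∈ range (K + 1), tiltedMean (R.μ n) (R.ρ₀ n) (R.σ n) (R.W n) (R.W n) t

/-- The centred action is the action minus its linear part. [folklore] -/
theorem centred_eq (R : DecoupledRun Z) (K : ℕ) (t : ℂ) :
    centred R K t = dressedAction R K t - t * ∑ n ∈ range (K + 1), R.c n := by
  rw [centred, dressedAction, sum_sub_distrib, mul_sum]

/-- On the window every source lies in every depth's tilt disc for the observable's bound: `s + ‖t‖·B ≤ 1`. [folklore] -/
theorem disc_B (R : DecoupledRun Z) {t : ℂ} (ht : ‖t‖ ≤ R.l₀) : R.s + ‖t‖ * R.B ≤ 1 := by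
  have := mul_le_mul_of_nonneg_right ht (B_nonneg R); linarith [R.hdiscB]

/-! ## §2 The (2.18)-type representation with the observable attached, and the K-uniform first-order bound -/

/-- **EXPONENTIATION, DEPTH BY DEPTH** [`B16DressedActionTerm.exp_dressLog_mul` BY NAME]: on the window
`Znorm R K t = Znorm R K 0 · e^{dressedAction R K t}` — the dressed normalisation IS the undressed one times the exponential of the total born
dressed action: the (2.18)-type representation extended by the observable-attached term, in the model. -/
theorem Znorm_eq_mul_exp (R : DecoupledRun Z) (K : ℕ) {t : ℂ} (ht : ‖t‖ ≤ R.l₀) :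
    Znorm R K t = Znorm R K 0 * Complex.exp (dressedAction R K t) := by
  rw [Znorm, Znorm, dressedAction, Complex.exp_sum, ← prod_mul_distrib]
  refine prod_congr rfl fun n _ => ?_
  rw [mul_comm, exp_dressLog_mul (R.hρ n) (R.hρ0 n) (R.hP n) (R.hσm n) (R.hWm n) (R.hσ n) (R.hW n) (disc_B R ht)]

/-- The geometric series of the depth decay: `Σ_{n < N} θⁿ ≤ (1 − θ)⁻¹`. [folklore] -/
theorem geom_sum_θ_le (R : DecoupledRun Z) (N : ℕ) : ∑ n ∈ range N, R.θ ^ n ≤ (1 - R.θ)⁻¹ := by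
  have h1 : 0 < 1 - R.θ := sub_pos.mpr R.hθ1
  have hmul : (∑ n ∈ range N, R.θ ^ n) * (1 - R.θ) = 1 - R.θ ^ N := geom_sum_mul_neg R.θ N
  have hle : (∑ n ∈ range N, R.θ ^ n) * (1 - R.θ) ≤ 1 := by
    rw [hmul]; linarith [pow_nonneg R.hθ0 N]
  rwa [← le_div_iff₀ h1, one_div] at hle

/-- **THE K-UNIFORM FIRST-ORDER BOUND** [part 1's `birthSize_le`, summed]: for EVERY cutoff `K` and every source in the window,
`‖centred R K t‖ ≤ amp·(1 − θ)⁻¹` — the centred dressed action lies in ONE K-free disc.  This is row NE1′'s uniformity «in the cutoff and in the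
source on a window» for the exponential's observable-attached term, a theorem of the model. -/
theorem norm_centred_le (R : DecoupledRun Z) (K : ℕ) {t : ℂ} (ht : ‖t‖ ≤ R.l₀) : ‖centred R K t‖ ≤ amp R * (1 - R.θ)⁻¹ := by
  calc ‖centred R K t‖ ≤ ∑ n ∈ range (K + 1), birthSize R n t := norm_sum_le _ _
    _ ≤ ∑ n ∈ range (K + 1), amp R * R.θ ^ n := sum_le_sum fun n _ => birthSize_le R n ht
    _ = amp R * ∑ n ∈ range (K + 1), R.θ ^ n := by rw [mul_sum]
    _ ≤ amp R * (1 - R.θ)⁻¹ := mul_le_mul_of_nonneg_left (geom_sum_θ_le R (K + 1)) (amp_nonneg R)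

/-! ## §3 Holomorphy in the source: the logarithmic derivative is the run's tilted mean -/

/-- **THE LOGARITHMIC DERIVATIVE** [`hasDerivAt_dressLog` BY NAME, summed]: on the closed window `d∕dt dressedAction R K t = tiltedMeanSum R K t`. -/
theorem hasDerivAt_dressedAction (R : DecoupledRun Z) (K : ℕ) {t : ℂ} (ht : ‖t‖ ≤ R.l₀) :
    HasDerivAt (dressedAction R K) (tiltedMeanSum R K t) t := by
  have h := HasDerivAt.sum (u := range (K + 1))
    (A := fun n τ => dressLog (R.μ n) (R.ρ₀ n) (R.σ n) (R.W n) τ)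
    (A' := fun n => tiltedMean (R.μ n) (R.ρ₀ n) (R.σ n) (R.W n) (R.W n) t) (x := t)
    fun n _ => hasDerivAt_dressLog (R.hρ n) (R.hρ0 n) (R.hP n) (R.hσm n) (R.hWm n) (R.hσ n) (R.hW n) (disc_B R ht)
  have hfun : (∑ n ∈ range (K + 1), fun τ => dressLog (R.μ n) (R.ρ₀ n) (R.σ n) (R.W n) τ) = dressedAction R K := by
    funext τ; simp only [Finset.sum_apply]; rfl
  rw [hfun] at h
  exact h

/-- Holomorphy on the open window `‖t‖ < l₀`. [folklore] -/
theorem differentiableOn_dressedAction (R : DecoupledRun Z) (K : ℕ) :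
    DifferentiableOn ℂ (dressedAction R K) (Metric.ball (0 : ℂ) R.l₀) := fun t ht =>
  (hasDerivAt_dressedAction R K (le_of_lt (by simpa using ht))).differentiableAt.differentiableWithinAt

/-- Analyticity on the open window (holomorphy on an open set). [folklore] -/
theorem analyticOnNhd_dressedAction (R : DecoupledRun Z) (K : ℕ) :
    AnalyticOnNhd ℂ (dressedAction R K) (Metric.ball (0 : ℂ) R.l₀) :=
  (differentiableOn_dressedAction R K).analyticOnNhd Metric.isOpen_ball

/-! ## §4 Two runs: the residual is the deepest born term — summable, so the `K → ∞` limit exists -/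

/-- One more depth adds one born term. [folklore] -/
theorem centred_succ (R : DecoupledRun Z) (K : ℕ) (t : ℂ) :
    centred R (K + 1) t = centred R K t + (dressLog (R.μ (K + 1)) (R.ρ₀ (K + 1)) (R.σ (K + 1)) (R.W (K + 1)) t - t * R.c (K + 1)) := by
  rw [centred, sum_range_succ, centred]

/-- **THE TWO-RUN RESIDUAL** [part 1's `birthSize_le` at the deepest birth]: on the window the centred dressed actions of the runs with cutoffs
`K + 1` and `K` differ by at most `amp·θ^{K+1}`. -/
theorem norm_centred_succ_sub_le (R : DecoupledRun Z) (K : ℕ) {t : ℂ} (ht : ‖t‖ ≤ R.l₀) :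
    ‖centred R (K + 1) t - centred R K t‖ ≤ amp R * R.θ ^ (K + 1) := by
  rw [centred_succ, add_sub_cancel_left]
  exact birthSize_le R (K + 1) ht

/-- Hence the sequence of centred dressed actions is CAUCHY in the cutoff, at every source of the window (`cauchySeq_of_le_geometric`). [folklore] -/
theorem cauchySeq_centred (R : DecoupledRun Z) {t : ℂ} (ht : ‖t‖ ≤ R.l₀) : CauchySeq fun K => centred R K t := by
  refine cauchySeq_of_le_geometric R.θ (amp R * R.θ) R.hθ1 fun K => ?_
  rw [dist_eq_norm, ← norm_neg, neg_sub, mul_assoc, ← pow_succ']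
  exact norm_centred_succ_sub_le R K ht

/-- **THE `K → ∞` LIMIT OF THE CENTRED DRESSED ACTION EXISTS** at every source of the K-free window — the apex sentence of the T⁴ programme for
the dressed free energy (existence of the `ε = L^{−K} → 0` limit), in the decoupled caricature. [folklore] -/
theorem tendsto_centred (R : DecoupledRun Z) {t : ℂ} (ht : ‖t‖ ≤ R.l₀) :
    ∃ D : ℂ, Tendsto (fun K => centred R K t) atTop (𝓝 D) :=
  cauchySeq_tendsto_of_complete (cauchySeq_centred R ht)

/-- The limit inherits the K-uniform disc: `‖lim_K centred R K t‖ ≤ amp·(1 − θ)⁻¹`. [folklore] -/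
theorem norm_lim_centred_le (R : DecoupledRun Z) {t : ℂ} (ht : ‖t‖ ≤ R.l₀) {D : ℂ}
    (hD : Tendsto (fun K => centred R K t) atTop (𝓝 D)) : ‖D‖ ≤ amp R * (1 - R.θ)⁻¹ :=
  le_of_tendsto' (hD.norm) fun K => norm_centred_le R K ht

/-- **THE TAIL, ALL CUTOFFS AT ONCE**: for `K ≤ K'`, `‖centred R K' t − centred R K t‖ ≤ amp·θ^{K+1}·(1 − θ)⁻¹` on the window — uniformly in
the source (the geometric tail). [folklore] -/
theorem norm_centred_sub_le (R : DecoupledRun Z) {t : ℂ} (ht : ‖t‖ ≤ R.l₀) {K K' : ℕ} (hKK' : K ≤ K') :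
    ‖centred R K' t - centred R K t‖ ≤ amp R * R.θ ^ (K + 1) * (1 - R.θ)⁻¹ := by
  have htail : ‖centred R K' t - centred R K t‖ ≤ ∑ i ∈ Finset.Ico K K', amp R * R.θ ^ (i + 1) := by
    induction K', hKK' using Nat.le_induction with
    | base => simp
    | succ K' hK ih =>
      calc ‖centred R (K' + 1) t - centred R K t‖
          ≤ ‖centred R (K' + 1) t - centred R K' t‖ + ‖centred R K' t - centred R K t‖ := norm_sub_le_norm_sub_add_norm_sub _ _ _
        _ ≤ amp R * R.θ ^ (K' + 1) + ∑ i ∈ Finset.Ico K K', amp R * R.θ ^ (i + 1) :=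
            add_le_add (norm_centred_succ_sub_le R K' ht) ih
        _ = ∑ i ∈ Finset.Ico K (K' + 1), amp R * R.θ ^ (i + 1) := by rw [Finset.sum_Ico_succ_top hK, add_comm]
  refine htail.trans ?_
  rw [Finset.sum_Ico_eq_sum_range]
  calc ∑ m ∈ range (K' - K), amp R * R.θ ^ (K + m + 1)
      = amp R * R.θ ^ (K + 1) * ∑ m ∈ range (K' - K), R.θ ^ m := by
        rw [mul_sum]; refine sum_congr rfl fun m _ => ?_; rw [show K + m + 1 = (K + 1) + m by ring, pow_add]; ring
    _ ≤ amp R * R.θ ^ (K + 1) * (1 - R.θ)⁻¹ :=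
        mul_le_mul_of_nonneg_left (geom_sum_θ_le R _) (mul_nonneg (amp_nonneg R) (pow_nonneg R.hθ0 _))

/-- **THE CONTINUUM (CENTRED) DRESSED ACTION OF THE MODEL** [model]: the `K → ∞` limit at the source `t` (Mathlib `limUnder`; meaningful on
the window, where §4 shows the limit exists). -/
def centredLim (R : DecoupledRun Z) (t : ℂ) : ℂ := limUnder atTop fun K => centred R K t

/-- On the window the centred dressed actions CONVERGE to `centredLim R t`. [folklore] -/
theorem tendsto_centredLim (R : DecoupledRun Z) {t : ℂ} (ht : ‖t‖ ≤ R.l₀) :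
    Tendsto (fun K => centred R K t) atTop (𝓝 (centredLim R t)) :=
  (cauchySeq_centred R ht).tendsto_limUnder

/-- **RATE OF CONVERGENCE, UNIFORM IN THE SOURCE**: `‖centredLim R t − centred R K t‖ ≤ amp·θ^{K+1}·(1 − θ)⁻¹` on the window. [folklore] -/
theorem norm_centredLim_sub_le (R : DecoupledRun Z) {t : ℂ} (ht : ‖t‖ ≤ R.l₀) (K : ℕ) :
    ‖centredLim R t - centred R K t‖ ≤ amp R * R.θ ^ (K + 1) * (1 - R.θ)⁻¹ := by
  have hlim : Tendsto (fun K' => ‖centred R K' t - centred R K t‖) atTop (𝓝 ‖centredLim R t - centred R K t‖) :=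
    ((tendsto_centredLim R ht).sub_const _).norm
  exact le_of_tendsto hlim (Filter.eventually_atTop.mpr ⟨K, fun K' hK' => norm_centred_sub_le R ht hK'⟩)

/-- **UNIFORM CONVERGENCE ON THE WINDOW**: `centred R K → centredLim R` uniformly on `‖t‖ ≤ l₀` as `K → ∞` (the rate above does not see the
source). [folklore] -/
theorem tendstoUniformlyOn_centred (R : DecoupledRun Z) :
    TendstoUniformlyOn (fun K t => centred R K t) (centredLim R) atTop {t : ℂ | ‖t‖ ≤ R.l₀} := by
  rw [Metric.tendstoUniformlyOn_iff]
  intro ε hε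
  have h1 : 0 < 1 - R.θ := sub_pos.mpr R.hθ1
  -- the K-free factor `amp·θ·(1−θ)⁻¹` times `θ^K → 0`
  have hpow : Tendsto (fun K : ℕ => amp R * R.θ * (1 - R.θ)⁻¹ * R.θ ^ K) atTop (𝓝 (amp R * R.θ * (1 - R.θ)⁻¹ * 0)) :=
    (tendsto_pow_atTop_nhds_zero_of_lt_one R.hθ0 R.hθ1).const_mul _
  rw [mul_zero] at hpow
  have hev := (tendsto_order.mp hpow).2 ε hε
  filter_upwards [hev] with K hK t ht
  rw [dist_eq_norm]
  calc ‖centredLim R t - centred R K t‖ ≤ amp R * R.θ ^ (K + 1) * (1 - R.θ)⁻¹ := norm_centredLim_sub_le R ht K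
    _ = amp R * R.θ * (1 - R.θ)⁻¹ * R.θ ^ K := by rw [pow_succ']; ring
    _ < ε := hK

/-- The centred action is holomorphic on the open window (the action minus a linear function). [folklore] -/
theorem differentiableOn_centred (R : DecoupledRun Z) (K : ℕ) : DifferentiableOn ℂ (centred R K) (Metric.ball (0 : ℂ) R.l₀) := by
  have h : centred R K = fun t => dressedAction R K t - t * ∑ n ∈ range (K + 1), R.c n := by
    funext t; exact centred_eq R K t
  rw [h]
  exact (differentiableOn_dressedAction R K).sub ((differentiableOn_id).mul (differentiableOn_const _))

/-- **THE CONTINUUM DRESSED ACTION IS HOLOMORPHIC IN THE SOURCE** on the open K-free window `‖t‖ < l₀` — a locally uniform limit of holomorphic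
functions (Mathlib `TendstoLocallyUniformlyOn.differentiableOn`): the model's version of «analyticity in μ of the continuum limit», the input the
T⁴ apex's Cauchy∕moment road (U5, N19) asks of the dressed free energy. [folklore] -/
theorem differentiableOn_centredLim (R : DecoupledRun Z) : DifferentiableOn ℂ (centredLim R) (Metric.ball (0 : ℂ) R.l₀) := by
  have hsub : Metric.ball (0 : ℂ) R.l₀ ⊆ {t : ℂ | ‖t‖ ≤ R.l₀} := fun t ht => le_of_lt (by simpa using ht)
  have hloc : TendstoLocallyUniformlyOn (fun K t => centred R K t) (centredLim R) atTop (Metric.ball (0 : ℂ) R.l₀) :=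
    ((tendstoUniformlyOn_centred R).mono hsub).tendstoLocallyUniformlyOn
  exact hloc.differentiableOn (Filter.Eventually.of_forall fun K => differentiableOn_centred R K) Metric.isOpen_ball

/-! ## §5 The model's twin of the residual `TiltedMeanMatching`: the two runs' tilted means agree within a summable `η` -/

/-- **THE RESIDUAL's MAJORANT IN THE MODEL** `eta R K = e^{3(s+l₀B)}·C·θ^{K+1}` [model]. -/
def eta (R : DecoupledRun Z) (K : ℕ) : ℝ := Real.exp (3 * (R.s + R.l₀ * R.B)) * R.C * R.θ ^ (K + 1)

/-- The majorant is nonnegative. [folklore] -/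
theorem eta_nonneg (R : DecoupledRun Z) (K : ℕ) : 0 ≤ eta R K := by
  unfold eta; exact mul_nonneg (mul_nonneg (Real.exp_pos _).le R.hC) (pow_nonneg R.hθ0 _)

/-- **THE MAJORANT IS SUMMABLE** (geometric, `θ < 1`) — the `hηs` input of `DressedMGFForm.hybridNE7_of_mgfForm`, in the model. [folklore] -/
theorem summable_eta (R : DecoupledRun Z) : Summable (eta R) := by
  have h := (summable_geometric_of_lt_one R.hθ0 R.hθ1).mul_left (Real.exp (3 * (R.s + R.l₀ * R.B)) * R.C * R.θ)
  refine h.congr fun K => ?_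
  simp only [eta, pow_succ']; ring

/-- One more depth adds one tilted mean. [folklore] -/
theorem tiltedMeanSum_succ (R : DecoupledRun Z) (K : ℕ) (t : ℂ) :
    tiltedMeanSum R (K + 1) t =
      tiltedMeanSum R K t + tiltedMean (R.μ (K + 1)) (R.ρ₀ (K + 1)) (R.σ (K + 1)) (R.W (K + 1)) (R.W (K + 1)) t := by
  rw [tiltedMeanSum, sum_range_succ, tiltedMeanSum]

/-- The tilted mean of a fibre piece past its constant is the tilted mean of its OSCILLATING part, bounded by (1.75)ₜ:
`‖E⁽ⁿ⁾_t W_n − c_n‖ ≤ e^{3(s+‖t‖B)}·C·θⁿ` (`tiltedMean_sub_const`, `norm_tiltedMean_le` BY NAME). [folklore] -/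
theorem norm_tiltedMean_sub_c_le (R : DecoupledRun Z) (n : ℕ) {t : ℂ} (ht : ‖t‖ ≤ R.l₀) :
    ‖tiltedMean (R.μ n) (R.ρ₀ n) (R.σ n) (R.W n) (R.W n) t - R.c n‖ ≤ Real.exp (3 * (R.s + ‖t‖ * R.B)) * (R.C * R.θ ^ n) := by
  rw [← tiltedMean_sub_const (F := ℂ) (R.hρ n) (R.hρ0 n) (R.hP n) (R.hσm n) (R.hWm n) (R.hσ n) (R.hW n) (R.hWm n) (R.hW n)
    (R.c n) (disc_B R ht)]
  exact norm_tiltedMean_le (R.hρ n) (R.hρ0 n) (R.hP n) (R.hσm n) (R.hWm n) (R.hσ n) (R.hW n) (R.hosc n)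
    (mul_nonneg R.hC (pow_nonneg R.hθ0 n)) (disc_B R ht)

/-- **THE MODEL's TWIN OF `TiltedMeanMatching`** [complex currency]: on the window, the CENTRED source-tilted means of the observable under the runs
with cutoffs `K + 1` and `K` agree within `eta R K` — summable in `K` (`summable_eta`): the pair (`hη`, `hηs`) the MGF road consumes, here a
theorem because the two decoupled runs share their top depths identically and the deepest piece oscillates by `C·θ^{K+1}`. -/
theorem norm_tiltedMeanSum_succ_sub_le (R : DecoupledRun Z) (K : ℕ) {t : ℂ} (ht : ‖t‖ ≤ R.l₀) :
    ‖(tiltedMeanSum R (K + 1) t - ∑ n ∈ range (K + 2), R.c n) - (tiltedMeanSum R K t - ∑ n ∈ range (K + 1), R.c n)‖ ≤ eta R K := by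
  have hrw : (tiltedMeanSum R (K + 1) t - ∑ n ∈ range (K + 2), R.c n) - (tiltedMeanSum R K t - ∑ n ∈ range (K + 1), R.c n)
      = tiltedMean (R.μ (K + 1)) (R.ρ₀ (K + 1)) (R.σ (K + 1)) (R.W (K + 1)) (R.W (K + 1)) t - R.c (K + 1) := by
    rw [tiltedMeanSum_succ, sum_range_succ (fun n => R.c n) (K + 1)]; ring
  rw [hrw]
  refine (norm_tiltedMean_sub_c_le R (K + 1) ht).trans ?_
  unfold eta
  have hexp : Real.exp (3 * (R.s + ‖t‖ * R.B)) ≤ Real.exp (3 * (R.s + R.l₀ * R.B)) :=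
    Real.exp_le_exp.mpr (by nlinarith [mul_le_mul_of_nonneg_right ht (B_nonneg R)])
  calc Real.exp (3 * (R.s + ‖t‖ * R.B)) * (R.C * R.θ ^ (K + 1))
      ≤ Real.exp (3 * (R.s + R.l₀ * R.B)) * (R.C * R.θ ^ (K + 1)) :=
        mul_le_mul_of_nonneg_right hexp (mul_nonneg R.hC (pow_nonneg R.hθ0 _))
    _ = Real.exp (3 * (R.s + R.l₀ * R.B)) * R.C * R.θ ^ (K + 1) := by ring

/-- **ALL RUNS AT ONCE**: for cutoffs `K ≤ K'` the centred tilted means differ by at most the tail `Σ_{K ≤ i < K'} eta R i` — the two-run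
statement iterated (triangle inequality). [folklore] -/
theorem norm_tiltedMeanSum_sub_le_sum (R : DecoupledRun Z) {t : ℂ} (ht : ‖t‖ ≤ R.l₀) {K K' : ℕ} (hKK' : K ≤ K') :
    ‖(tiltedMeanSum R K' t - ∑ n ∈ range (K' + 1), R.c n) - (tiltedMeanSum R K t - ∑ n ∈ range (K + 1), R.c n)‖ ≤
      ∑ i ∈ Finset.Ico K K', eta R i := by
  induction K', hKK' using Nat.le_induction with
  | base => simp
  | succ K' hK ih =>
    calc ‖(tiltedMeanSum R (K' + 1) t - ∑ n ∈ range (K' + 1 + 1), R.c n) - (tiltedMeanSum R K t - ∑ n ∈ range (K + 1), R.c n)‖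
        ≤ ‖(tiltedMeanSum R (K' + 1) t - ∑ n ∈ range (K' + 2), R.c n) - (tiltedMeanSum R K' t - ∑ n ∈ range (K' + 1), R.c n)‖ +
            ‖(tiltedMeanSum R K' t - ∑ n ∈ range (K' + 1), R.c n) - (tiltedMeanSum R K t - ∑ n ∈ range (K + 1), R.c n)‖ :=
          norm_sub_le_norm_sub_add_norm_sub _ _ _
      _ ≤ eta R K' + ∑ i ∈ Finset.Ico K K', eta R i := add_le_add (norm_tiltedMeanSum_succ_sub_le R K' ht) ih
      _ = ∑ i ∈ Finset.Ico K (K' + 1), eta R i := by rw [Finset.sum_Ico_succ_top hK, add_comm]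

/-- **THE CENTRED TILTED MEANS CONVERGE AS `K → ∞`** at every source of the window (geometric two-run bound ⇒ Cauchy): the model's continuum
limit of the (centred) source-tilted expectation of the observable. [folklore] -/
theorem tendsto_tiltedMeanSum_centred (R : DecoupledRun Z) {t : ℂ} (ht : ‖t‖ ≤ R.l₀) :
    ∃ E : ℂ, Tendsto (fun K => tiltedMeanSum R K t - ∑ n ∈ range (K + 1), R.c n) atTop (𝓝 E) := by
  refine cauchySeq_tendsto_of_complete (cauchySeq_of_le_geometric R.θ (Real.exp (3 * (R.s + R.l₀ * R.B)) * R.C * R.θ) R.hθ1 fun K => ?_)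
  rw [dist_eq_norm, ← norm_neg, neg_sub]
  refine (norm_tiltedMeanSum_succ_sub_le R K ht).trans (le_of_eq ?_)
  simp only [eta, pow_succ']; ring

/-- The centred action is differentiable in the source on the closed window, with derivative the CENTRED tilted mean. [folklore] -/
theorem hasDerivAt_centred (R : DecoupledRun Z) (K : ℕ) {t : ℂ} (ht : ‖t‖ ≤ R.l₀) :
    HasDerivAt (centred R K) (tiltedMeanSum R K t - ∑ n ∈ range (K + 1), R.c n) t := by
  have h : centred R K = fun τ => dressedAction R K τ - τ * ∑ n ∈ range (K + 1), R.c n := by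
    funext τ; exact centred_eq R K τ
  rw [h]
  have hlin : HasDerivAt (fun τ : ℂ => τ * ∑ n ∈ range (K + 1), R.c n) (1 * ∑ n ∈ range (K + 1), R.c n) t :=
    (hasDerivAt_id t).mul_const _
  rw [one_mul] at hlin
  exact (hasDerivAt_dressedAction R K ht).sub hlin

/-- **THE CONTINUUM TILTED MEAN IS THE SOURCE-DERIVATIVE OF THE CONTINUUM DRESSED ACTION**: on the open window the centred tilted means
`E_K(t) − Σ_{n≤K} c_n` converge to `deriv (centredLim R) t` (derivatives of a locally uniform limit of holomorphic functions converge, Mathlib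
`TendstoLocallyUniformlyOn.deriv`) — the limit of `tendsto_tiltedMeanSum_centred` identified. [folklore] -/
theorem tendsto_tiltedMeanSum_deriv_centredLim (R : DecoupledRun Z) {t : ℂ} (ht : ‖t‖ < R.l₀) :
    Tendsto (fun K => tiltedMeanSum R K t - ∑ n ∈ range (K + 1), R.c n) atTop (𝓝 (deriv (centredLim R) t)) := by
  have hsub : Metric.ball (0 : ℂ) R.l₀ ⊆ {t : ℂ | ‖t‖ ≤ R.l₀} := fun t ht => le_of_lt (by simpa using ht)
  have hloc : TendstoLocallyUniformlyOn (fun K t => centred R K t) (centredLim R) atTop (Metric.ball (0 : ℂ) R.l₀) :=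
    ((tendstoUniformlyOn_centred R).mono hsub).tendstoLocallyUniformlyOn
  have hder := hloc.deriv (Filter.Eventually.of_forall fun K => differentiableOn_centred R K) Metric.isOpen_ball
  have hmem : t ∈ Metric.ball (0 : ℂ) R.l₀ := by simpa using ht
  have hpt := hder.tendsto_at hmem
  refine hpt.congr fun K => ?_
  show deriv (centred R K) t = tiltedMeanSum R K t - ∑ n ∈ range (K + 1), R.c n
  exact (hasDerivAt_centred R K (le_of_lt ht)).deriv

end YMDAG.N14.Decoupled

end
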